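import Summits.HubbardSuperconductivity.HubbardSuperconductivity.Theorems.NodalWardXYNodalPropagatorDecayProfileBounds
import Summits.HubbardSuperconductivity.HubbardSuperconductivity.Theorems.NodalWardXYNodalPropagatorDecayOscillatory
import Literature.Analysis.Complex.StripResidueFormula

/-!
# Nodal propagator decay (route `NodalWardXY`, item `NodalPropagatorDecay`): I-c. `L¹` bounds and
# Fourier decay of the profile

The majorant `maj⟪l,s⟫ = (l + l² + l³) e^{-lρ(s)} + 1/ρ(s)²` of files I/I-b has
`∫_x^y maj ≤ 80` uniformly in `l ≥ 0` (`∫ ds/(1+s²) = π`, `∫ e^{-c|s|} ds = 2/c` and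
`l^k e^{-l/2} ≤ const`), hence `‖prof_k‖_{L¹(any interval)} ≤ 240, 560, 3360`; plugged into the
generic decay estimate of file II this gives `profile_fourier_bound`:
`‖∫_{-π}^{π} e^{inθ} prof⟪l,α,β,γ, a cos θ + b⟫ dθ‖ ≤ 480/|n|` and `≤ 2(240 + 1680a + 3360a²)/|n|³`.
No definitions (local notations only).
-/

noncomputable section

namespace Summit.HubbardSuperconductivity.HubbardSuperconductivity.Theorems

namespace NodalDecay

open Real MeasureTheory intervalIntegral

/-! ### Local notation (identical in every file of this proof; no definitions) -/

local notation "ρ⟪" s "⟫" => Real.sqrt (1 + s ^ 2)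
local notation "θ⟪" s "⟫" => s / ρ⟪s⟫
local notation "θ1⟪" s "⟫" => 1 / ρ⟪s⟫ ^ 3
local notation "θ2⟪" s "⟫" => -3 * s / ρ⟪s⟫ ^ 5
local notation "P0⟪" l ", " s "⟫" => Real.exp (-(l * ρ⟪s⟫))
local notation "P1⟪" l ", " s "⟫" => -l * θ⟪s⟫ * P0⟪l, s⟫
local notation "P2⟪" l ", " s "⟫" => (-l * θ1⟪s⟫ + l ^ 2 * θ⟪s⟫ ^ 2) * P0⟪l, s⟫
local notation "P3⟪" l ", " s "⟫" =>
  (-l * θ2⟪s⟫ + 3 * l ^ 2 * θ⟪s⟫ * θ1⟪s⟫ - l ^ 3 * θ⟪s⟫ ^ 3) * P0⟪l, s⟫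
local notation "Q0⟪" α ", " β ", " γ ", " s "⟫" => γ + (α + β * s) / ρ⟪s⟫
local notation "Q1⟪" α ", " β ", " s "⟫" => (β - α * s) / ρ⟪s⟫ ^ 3
local notation "Q2⟪" α ", " β ", " s "⟫" => -α / ρ⟪s⟫ ^ 3 - 3 * s * (β - α * s) / ρ⟪s⟫ ^ 5
local notation "Q3⟪" α ", " β ", " s "⟫" =>
  (9 * α * s - 3 * β) / ρ⟪s⟫ ^ 5 + 15 * s ^ 2 * (β - α * s) / ρ⟪s⟫ ^ 7
local notation "prof⟪" l ", " α ", " β ", " γ ", " s "⟫" => P0⟪l, s⟫ * Q0⟪α, β, γ, s⟫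
local notation "prof1⟪" l ", " α ", " β ", " γ ", " s "⟫" =>
  P1⟪l, s⟫ * Q0⟪α, β, γ, s⟫ + P0⟪l, s⟫ * Q1⟪α, β, s⟫
local notation "prof2⟪" l ", " α ", " β ", " γ ", " s "⟫" =>
  P2⟪l, s⟫ * Q0⟪α, β, γ, s⟫ + 2 * (P1⟪l, s⟫ * Q1⟪α, β, s⟫) + P0⟪l, s⟫ * Q2⟪α, β, s⟫
local notation "prof3⟪" l ", " α ", " β ", " γ ", " s "⟫" =>
  P3⟪l, s⟫ * Q0⟪α, β, γ, s⟫ + 3 * (P2⟪l, s⟫ * Q1⟪α, β, s⟫) + 3 * (P1⟪l, s⟫ * Q2⟪α, β, s⟫)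
    + P0⟪l, s⟫ * Q3⟪α, β, s⟫
local notation "maj⟪" l ", " s "⟫" => (l + l ^ 2 + l ^ 3) * P0⟪l, s⟫ + 1 / ρ⟪s⟫ ^ 2

/-- The phase `e^{i n θ}` written exactly as it appears in the item (`exp (I · ↑(θ · n))`). -/
local notation "e⟪" n ", " θ "⟫" => Complex.exp (Complex.I * (((θ : ℝ) * ((n : ℤ) : ℝ) : ℝ) : ℂ))

/-! ### `L¹` bounds for the profile, uniformly in `l ≥ 0` -/

/-- `∫_x^y ds/ρ(s)² ≤ π`. -/
theorem integral_inv_rho_sq_le {x y : ℝ} (hxy : x ≤ y) : ∫ s in x..y, 1 / ρ⟪s⟫ ^ 2 ≤ π := by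
  calc ∫ s in x..y, 1 / ρ⟪s⟫ ^ 2 = ∫ s in x..y, (1 + s ^ 2)⁻¹ := by
        congr 1; ext s; rw [Real.sq_sqrt (by positivity), one_div]
    _ = ∫ s in Set.Ioc x y, (1 + s ^ 2)⁻¹ := intervalIntegral.integral_of_le hxy
    _ ≤ ∫ s, (1 + s ^ 2)⁻¹ :=
        setIntegral_le_integral integrable_inv_one_add_sq
          (Filter.Eventually.of_forall fun s => by positivity)
    _ = π := integral_univ_inv_one_add_sq

/-- `∫_x^y e^{-c|s|} ds ≤ 2/c` for `c > 0`. -/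
theorem integral_exp_neg_mul_abs_le {c : ℝ} (hc : 0 < c) {x y : ℝ} (hxy : x ≤ y) :
    ∫ s in x..y, Real.exp (-c * |s|) ≤ 2 / c := by
  have hI := Literature.Analysis.Complex.integrable_exp_neg_mul_abs hc
  calc ∫ s in x..y, Real.exp (-c * |s|) = ∫ s in Set.Ioc x y, Real.exp (-c * |s|) :=
        intervalIntegral.integral_of_le hxy
    _ ≤ ∫ s, Real.exp (-c * |s|) :=
        setIntegral_le_integral hI (Filter.Eventually.of_forall fun s => (Real.exp_pos _).le)
    _ = 2 * ∫ s in Set.Ioi 0, Real.exp (-c * s) := integral_comp_abs (f := fun s => Real.exp (-c * s))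
    _ = 2 / c := by
        rw [integral_exp_mul_Ioi (by linarith) 0, mul_zero, Real.exp_zero]
        field_simp

/-- `∫_x^y (l + l² + l³) e^{-lρ(s)} ds ≤ 76` for `l ≥ 0`. -/
theorem integral_poly_mul_P0_le {l : ℝ} (hl : 0 ≤ l) {x y : ℝ} (hxy : x ≤ y) :
    ∫ s in x..y, (l + l ^ 2 + l ^ 3) * P0⟪l, s⟫ ≤ 76 := by
  rcases hl.eq_or_lt with h0 | hlpos
  · rw [← h0]; simp
  set E : ℝ := Real.exp (-(l / 2)) with hE
  have hEpos : 0 < E := Real.exp_pos _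
  have hE1 : E ≤ 1 := by rw [hE, Real.exp_le_one_iff]; linarith
  -- l e^{-l/2} ≤ 2 and l² e^{-l/2} ≤ 16
  have hlE : l * E ≤ 2 := by
    have h1 := Real.add_one_le_exp (l / 2)
    have h2 : Real.exp (l / 2) * E = 1 := by rw [hE, ← Real.exp_add]; simp
    nlinarith [Real.exp_pos (l / 2)]
  have hl2E : l ^ 2 * E ≤ 16 := by
    have h1 := Real.add_one_le_exp (l / 4)
    have h2 : Real.exp (l / 4) ^ 2 * E = 1 := by
      rw [hE, sq, ← Real.exp_add, ← Real.exp_add, show l / 4 + l / 4 + -(l / 2) = 0 by ring,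
        Real.exp_zero]
    have h3 : l ≤ 4 * Real.exp (l / 4) := by linarith
    have h4 : l ^ 2 ≤ 16 * Real.exp (l / 4) ^ 2 := by nlinarith [Real.exp_pos (l / 4)]
    nlinarith [Real.exp_pos (l / 4)]
  -- pointwise domination
  have hpt : ∀ s : ℝ, (l + l ^ 2 + l ^ 3) * P0⟪l, s⟫ ≤
      (l + l ^ 2 + l ^ 3) * E * Real.exp (-(l / 2) * |s|) := by
    intro s
    rw [mul_assoc]
    apply mul_le_mul_of_nonneg_left _ (by positivity)
    rw [hE, ← Real.exp_add, Real.exp_le_exp]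
    have := mul_le_mul_of_nonneg_left (half_one_add_abs_le_rho s) hl
    linarith
  have hcont : Continuous fun s : ℝ => (l + l ^ 2 + l ^ 3) * P0⟪l, s⟫ := by fun_prop
  have hcont2 : Continuous fun s : ℝ => (l + l ^ 2 + l ^ 3) * E * Real.exp (-(l / 2) * |s|) := by
    fun_prop
  calc ∫ s in x..y, (l + l ^ 2 + l ^ 3) * P0⟪l, s⟫
      ≤ ∫ s in x..y, (l + l ^ 2 + l ^ 3) * E * Real.exp (-(l / 2) * |s|) :=
        intervalIntegral.integral_mono_on hxy (hcont.intervalIntegrable _ _)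
          (hcont2.intervalIntegrable _ _) (fun s _ => hpt s)
    _ = (l + l ^ 2 + l ^ 3) * E * ∫ s in x..y, Real.exp (-(l / 2) * |s|) :=
        intervalIntegral.integral_const_mul _ _
    _ ≤ (l + l ^ 2 + l ^ 3) * E * (2 / (l / 2)) := by
        apply mul_le_mul_of_nonneg_left (integral_exp_neg_mul_abs_le (by positivity) hxy)
        positivity
    _ = 4 * (E + l * E + l ^ 2 * E) := by field_simp; ring
    _ ≤ 4 * (1 + 2 + 16) := by gcongr
    _ = 76 := by norm_num

/-- `∫_x^y maj⟪l, s⟫ ds ≤ 80` for `l ≥ 0`. -/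
theorem integral_maj_le {l : ℝ} (hl : 0 ≤ l) {x y : ℝ} (hxy : x ≤ y) :
    ∫ s in x..y, maj⟪l, s⟫ ≤ 80 := by
  have hρc : Continuous fun s : ℝ => 1 / ρ⟪s⟫ ^ 2 :=
    continuous_const.div (continuous_rho.pow 2) (fun s => pow_ne_zero 2 (rho_pos s).ne')
  rw [intervalIntegral.integral_add (Continuous.intervalIntegrable (by fun_prop) _ _)
    (hρc.intervalIntegrable _ _)]
  have h1 := integral_poly_mul_P0_le hl hxy
  have h2 := integral_inv_rho_sq_le hxy
  linarith [Real.pi_le_four]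

/-- `∫_x^y |prof1| ≤ 240`. -/
theorem integral_abs_prof1_le {l α β γ : ℝ} (hl : 0 ≤ l) (hα : |α| ≤ 1) (hβ : |β| ≤ 1)
    (hγ : |γ| ≤ 1) {x y : ℝ} (hxy : x ≤ y) : ∫ s in x..y, |prof1⟪l, α, β, γ, s⟫| ≤ 240 := by
  obtain ⟨_, hc1, _, _⟩ := continuous_prof l α β γ
  have hm : Continuous fun s : ℝ => 3 * maj⟪l, s⟫ := by
    have := continuous_rho
    exact continuous_const.mul ((by fun_prop : Continuous fun s : ℝ => (l + l ^ 2 + l ^ 3) * P0⟪l, s⟫).add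
      (continuous_const.div (continuous_rho.pow 2) (fun s => pow_ne_zero 2 (rho_pos s).ne')))
  calc ∫ s in x..y, |prof1⟪l, α, β, γ, s⟫| ≤ ∫ s in x..y, 3 * maj⟪l, s⟫ :=
        intervalIntegral.integral_mono_on hxy (hc1.abs.intervalIntegrable _ _)
          (hm.intervalIntegrable _ _) (fun s _ => abs_prof1_le hl hα hβ hγ s)
    _ = 3 * ∫ s in x..y, maj⟪l, s⟫ := intervalIntegral.integral_const_mul _ _
    _ ≤ 3 * 80 := by have := integral_maj_le hl hxy; gcongr
    _ = 240 := by norm_num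

/-- `∫_x^y |prof2| ≤ 560`. -/
theorem integral_abs_prof2_le {l α β γ : ℝ} (hl : 0 ≤ l) (hα : |α| ≤ 1) (hβ : |β| ≤ 1)
    (hγ : |γ| ≤ 1) {x y : ℝ} (hxy : x ≤ y) : ∫ s in x..y, |prof2⟪l, α, β, γ, s⟫| ≤ 560 := by
  obtain ⟨_, _, hc2, _⟩ := continuous_prof l α β γ
  have hm : Continuous fun s : ℝ => 7 * maj⟪l, s⟫ := by
    have := continuous_rho
    exact continuous_const.mul ((by fun_prop : Continuous fun s : ℝ => (l + l ^ 2 + l ^ 3) * P0⟪l, s⟫).add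
      (continuous_const.div (continuous_rho.pow 2) (fun s => pow_ne_zero 2 (rho_pos s).ne')))
  calc ∫ s in x..y, |prof2⟪l, α, β, γ, s⟫| ≤ ∫ s in x..y, 7 * maj⟪l, s⟫ :=
        intervalIntegral.integral_mono_on hxy (hc2.abs.intervalIntegrable _ _)
          (hm.intervalIntegrable _ _) (fun s _ => abs_prof2_le hl hα hβ hγ s)
    _ = 7 * ∫ s in x..y, maj⟪l, s⟫ := intervalIntegral.integral_const_mul _ _
    _ ≤ 7 * 80 := by have := integral_maj_le hl hxy; gcongr
    _ = 560 := by norm_num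

/-- `∫_x^y |prof3| ≤ 3360`. -/
theorem integral_abs_prof3_le {l α β γ : ℝ} (hl : 0 ≤ l) (hα : |α| ≤ 1) (hβ : |β| ≤ 1)
    (hγ : |γ| ≤ 1) {x y : ℝ} (hxy : x ≤ y) : ∫ s in x..y, |prof3⟪l, α, β, γ, s⟫| ≤ 3360 := by
  obtain ⟨_, _, _, hc3⟩ := continuous_prof l α β γ
  have hm : Continuous fun s : ℝ => 42 * maj⟪l, s⟫ := by
    have := continuous_rho
    exact continuous_const.mul ((by fun_prop : Continuous fun s : ℝ => (l + l ^ 2 + l ^ 3) * P0⟪l, s⟫).add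
      (continuous_const.div (continuous_rho.pow 2) (fun s => pow_ne_zero 2 (rho_pos s).ne')))
  calc ∫ s in x..y, |prof3⟪l, α, β, γ, s⟫| ≤ ∫ s in x..y, 42 * maj⟪l, s⟫ :=
        intervalIntegral.integral_mono_on hxy (hc3.abs.intervalIntegrable _ _)
          (hm.intervalIntegrable _ _) (fun s _ => abs_prof3_le hl hα hβ hγ s)
    _ = 42 * ∫ s in x..y, maj⟪l, s⟫ := intervalIntegral.integral_const_mul _ _
    _ ≤ 42 * 80 := by have := integral_maj_le hl hxy; gcongr
    _ = 3360 := by norm_num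

/-! ### Fourier decay of the profile along `s = a cos θ + b` -/

/-- **Profile Fourier bound.**  For `l ≥ 0`, `|α|, |β|, |γ| ≤ 1`, `a ≥ 0`, `b ∈ ℝ`, `n ∈ ℤ ∖ {0}`:
`‖∫_{-π}^{π} e^{inθ} prof⟪l,α,β,γ, a cos θ + b⟫ dθ‖ ≤ 480/|n|` and
`≤ 2 (240 + 1680 a + 3360 a²)/|n|³`. -/
theorem profile_fourier_bound {l α β γ : ℝ} (hl : 0 ≤ l) (hα : |α| ≤ 1) (hβ : |β| ≤ 1)
    (hγ : |γ| ≤ 1) {a : ℝ} (ha : 0 ≤ a) (b : ℝ) {n : ℤ} (hn : n ≠ 0) :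
    ‖∫ θ in (-π)..π, e⟪n, θ⟫ * ((prof⟪l, α, β, γ, a * Real.cos θ + b⟫ : ℝ) : ℂ)‖
      ≤ 480 / |(n : ℝ)| ∧
    ‖∫ θ in (-π)..π, e⟪n, θ⟫ * ((prof⟪l, α, β, γ, a * Real.cos θ + b⟫ : ℝ) : ℂ)‖
      ≤ 2 * (240 + 3 * a * 560 + a ^ 2 * 3360) / |(n : ℝ)| ^ 3 := by
  obtain ⟨_, _, _, hc3⟩ := continuous_prof l α β γ
  have h := norm_integral_phase_comp_cos_le (f := fun s => prof⟪l, α, β, γ, s⟫)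
    (f1 := fun s => prof1⟪l, α, β, γ, s⟫) (f2 := fun s => prof2⟪l, α, β, γ, s⟫)
    (f3 := fun s => prof3⟪l, α, β, γ, s⟫) (A1 := 240) (A2 := 560) (A3 := 3360)
    (hasDerivAt_prof l α β γ) (hasDerivAt_prof1 l α β γ) (hasDerivAt_prof2 l α β γ) hc3
    (fun x y hxy => integral_abs_prof1_le hl hα hβ hγ hxy)
    (fun x y hxy => integral_abs_prof2_le hl hα hβ hγ hxy)
    (fun x y hxy => integral_abs_prof3_le hl hα hβ hγ hxy) ha b hn
  refine ⟨h.1.trans (le_of_eq ?_), h.2⟩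
  ring

end NodalDecay

end Summit.HubbardSuperconductivity.HubbardSuperconductivity.Theorems
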